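import Literature.Analysis.Calculus.EvolutionDerivBounds
import Mathlib.Analysis.Calculus.MeanValue
import Mathlib.Topology.Algebra.Module.FiniteDimension
import HarnessLib

/-!
# Spatial derivative bounds up to a finite order, and bounds by integration in time

Analysis/Calculus support file (everything proved, no named fact), the graded companion of
`EvolutionDerivBounds.lean`. There the class `SpatiallyBdd Ω u` (ALL spatial derivatives of
`u : E × ℝ → W` bounded on `Ω`) was shown to propagate through an evolution equation to all
space-time derivatives. The conversion of COVARIANT derivative bounds into coordinate derivative
bounds along a Ricci flow (Topping 2006, proof of Thm. 5.3.1, (5.3.3) ⇒ (5.3.4), p. 47; Hamilton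
1982, §14; the induction on the order written out in Chow–Knopf 2004, §6.7) is an induction on the
ORDER of differentiation, interleaved with integrations in time (the Christoffel symbols are
bounded by integrating `∂ₜΓ = g⁻¹ * ∇Ric`). This file supplies its bookkeeping:

* `SpatiallyBddUpTo Ω m u` — `u` is `C^∞` on `Ω` and `∂ʲ_y u` is bounded on `Ω` for `j ≤ m`;
  `spatiallyBdd_iff_forall_upTo`. Closure under sums, continuous (bi)linear maps, left
  composition with maps smooth near a compact set containing the range (graded Leibniz and chain
  rules from Mathlib's `ContinuousLinearMap.norm_iteratedFDerivWithin_le_of_bilinear`,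
  `norm_iteratedFDerivWithin_comp_le`), and the order shift
  `SpatiallyBddUpTo Ω (m+1) u ↔ (order 0) ∧ SpatiallyBddUpTo Ω m (∂_y u)`
  (`spatiallyBddUpTo_succ_iff_dY`), with the reconstruction of `∂_y u` from the directional
  derivatives along a basis (`SpatiallyBddUpTo.dY_of_basis`).
* `spatiallyBddUpTo_of_dT` — **bounds by integration in time** on a cylinder `B × (t₁, T)`:
  if `∂ʲ_y ∂ₜ u` (`j ≤ m`) is bounded on the cylinder and `∂ʲ_y u(·, t₂)` is bounded on `B` for one
  time `t₂ ∈ (t₁, T)`, then `∂ʲ_y u` is bounded on the cylinder (`∂ₜ ∂ʲ_y = ∂ʲ_y ∂ₜ` and the mean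
  value inequality on `[t, t₂]` or `[t₂, t]`; Topping 2006, p. 48: "by integrating with respect to
  time"); `exists_forall_norm_dYk_slice_le` gives the bound at `t₂` on a compact `B̄`.

## References

* P. Topping, *Lectures on the Ricci flow*, LMS Lecture Note Series 325, CUP 2006, proof of
  Thm. 5.3.1, pp. 47–48. [Topping2006]
* B. Chow, D. Knopf, *The Ricci flow: an introduction*, AMS 2004, §6.7 (derivative bounds of the
  metric from curvature derivative bounds). [ChowKnopf2004]
-/

noncomputable section

open Set Filter Function Metric
open scoped Topology ContDiff

namespace Literature.Analysis.Calculus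

-- operator spaces of iterated derivatives
set_option maxSynthPendingDepth 3

universe u v w

variable {E : Type u} [NormedAddCommGroup E] [NormedSpace ℝ E]
  {W : Type v} [NormedAddCommGroup W] [NormedSpace ℝ W]
  {W' : Type w} [NormedAddCommGroup W'] [NormedSpace ℝ W']
  {W₁ W₂ W₃ : Type*} [NormedAddCommGroup W₁] [NormedSpace ℝ W₁] [NormedAddCommGroup W₂]
  [NormedSpace ℝ W₂] [NormedAddCommGroup W₃] [NormedSpace ℝ W₃]

/-! ### Spatial derivatives bounded up to order `m` -/

section UpTo

variable (Ω : Set (E × ℝ)) in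
/-- **`u` is `C^∞` on `Ω` with the spatial derivatives of order `≤ m` bounded on `Ω`.**
[folklore] -/
structure SpatiallyBddUpTo (m : ℕ) (u : E × ℝ → W) : Prop where
  contDiffOn : ContDiffOn ℝ ∞ u Ω
  isBounded : ∀ j ≤ m, ∃ C : ℝ, ∀ q ∈ Ω, ‖dYk j u q‖ ≤ C

variable {Ω : Set (E × ℝ)} {u v : E × ℝ → W} {m : ℕ}

/-- All orders at once. [folklore] -/
theorem spatiallyBdd_iff_forall_upTo : SpatiallyBdd Ω u ↔ ∀ m, SpatiallyBddUpTo Ω m u :=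
  ⟨fun h _ ↦ ⟨h.contDiffOn, fun j _ ↦ h.isBounded j⟩,
    fun h ↦ ⟨(h 0).contDiffOn, fun m ↦ (h m).isBounded m le_rfl⟩⟩

/-- `SpatiallyBdd` gives every finite order. [folklore] -/
theorem SpatiallyBdd.upTo (h : SpatiallyBdd Ω u) (m : ℕ) : SpatiallyBddUpTo Ω m u :=
  spatiallyBdd_iff_forall_upTo.1 h m

/-- Monotonicity in the order. [folklore] -/
theorem SpatiallyBddUpTo.mono {j : ℕ} (h : SpatiallyBddUpTo Ω m u) (hjm : j ≤ m) :
    SpatiallyBddUpTo Ω j u :=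
  ⟨h.contDiffOn, fun i hi ↦ h.isBounded i (hi.trans hjm)⟩

/-- A nonnegative bounding sequence (meaningful for `j ≤ m`). [folklore] -/
theorem SpatiallyBddUpTo.bound (h : SpatiallyBddUpTo Ω m u) :
    ∃ C : ℕ → ℝ, (∀ j, 0 ≤ C j) ∧ ∀ j ≤ m, ∀ q ∈ Ω, ‖dYk j u q‖ ≤ C j := by
  have h' : ∀ j, ∃ C : ℝ, j ≤ m → ∀ q ∈ Ω, ‖dYk j u q‖ ≤ C := fun j ↦ by
    by_cases hj : j ≤ m
    · obtain ⟨C, hC⟩ := h.isBounded j hj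
      exact ⟨C, fun _ ↦ hC⟩
    · exact ⟨0, fun hj' ↦ absurd hj' hj⟩
  choose C hC using h'
  exact ⟨fun j ↦ max (C j) 0, fun j ↦ le_max_right _ _,
    fun j hj q hq ↦ (hC j hj q hq).trans (le_max_left _ _)⟩

/-- The function itself is bounded. [folklore] -/
theorem SpatiallyBddUpTo.norm_le (h : SpatiallyBddUpTo Ω m u) : ∃ C : ℝ, ∀ q ∈ Ω, ‖u q‖ ≤ C := by
  obtain ⟨C, hC⟩ := h.isBounded 0 (Nat.zero_le _)
  exact ⟨C, fun q hq ↦ by simpa using hC q hq⟩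

/-- Order zero from smoothness and a bound. [folklore] -/
theorem spatiallyBddUpTo_zero_iff :
    SpatiallyBddUpTo Ω 0 u ↔ ContDiffOn ℝ ∞ u Ω ∧ ∃ C : ℝ, ∀ q ∈ Ω, ‖u q‖ ≤ C := by
  constructor
  · exact fun h ↦ ⟨h.contDiffOn, h.norm_le⟩
  · rintro ⟨h1, C, hC⟩
    refine ⟨h1, fun j hj ↦ ?_⟩
    obtain rfl : j = 0 := Nat.le_zero.1 hj
    exact ⟨C, fun q hq ↦ by simpa using hC q hq⟩

/-- `SpatiallyBddUpTo` only depends on the values on the open set. [folklore] -/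
theorem SpatiallyBddUpTo.congr (hΩ : IsOpen Ω) (hu : SpatiallyBddUpTo Ω m u) (h : EqOn u v Ω) :
    SpatiallyBddUpTo Ω m v := by
  refine ⟨hu.contDiffOn.congr fun q hq ↦ (h hq).symm, fun j hj ↦ ?_⟩
  obtain ⟨C, hC⟩ := hu.isBounded j hj
  exact ⟨C, fun q hq ↦ by rw [← dYk_congr hΩ h hq j]; exact hC q hq⟩

/-- Constants. [folklore] -/
theorem SpatiallyBddUpTo.const (m : ℕ) (c : W) : SpatiallyBddUpTo Ω m (fun _ : E × ℝ ↦ c) :=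
  (SpatiallyBdd.const c).upTo m

/-- The first coordinate on a set bounded in space. [folklore] -/
theorem SpatiallyBddUpTo.fst {ρ : ℝ} (hρ : ∀ q ∈ Ω, ‖q.1‖ ≤ ρ) (m : ℕ) :
    SpatiallyBddUpTo Ω m (fun q : E × ℝ ↦ q.1) :=
  (SpatiallyBdd.fst hρ).upTo m

/-- Post-composition with a continuous linear map. [folklore] -/
theorem SpatiallyBddUpTo.clm_comp (hΩ : IsOpen Ω) (L : W →L[ℝ] W') (hu : SpatiallyBddUpTo Ω m u) :
    SpatiallyBddUpTo Ω m (fun p ↦ L (u p)) := by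
  refine ⟨L.contDiff.comp_contDiffOn hu.contDiffOn, fun j hj ↦ ?_⟩
  obtain ⟨C, hC⟩ := hu.isBounded j hj
  refine ⟨‖L‖ * C, fun q hq ↦ ?_⟩
  rw [dYk_clm_comp L j (contDiffAt_sliceY hΩ hu.contDiffOn hq)]
  exact (L.norm_compContinuousMultilinearMap_le _).trans (by gcongr; exact hC q hq)

/-- Evaluation of an operator-valued function at a fixed vector. [folklore] -/
theorem SpatiallyBddUpTo.apply_const (hΩ : IsOpen Ω) {u : E × ℝ → W₁ →L[ℝ] W₂}
    (hu : SpatiallyBddUpTo Ω m u) (w : W₁) : SpatiallyBddUpTo Ω m (fun p ↦ u p w) :=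
  hu.clm_comp hΩ (ContinuousLinearMap.apply ℝ W₂ w)

/-- Sums. [folklore] -/
theorem SpatiallyBddUpTo.add (hΩ : IsOpen Ω) (hu : SpatiallyBddUpTo Ω m u)
    (hv : SpatiallyBddUpTo Ω m v) : SpatiallyBddUpTo Ω m (u + v) := by
  refine ⟨hu.contDiffOn.add hv.contDiffOn, fun j hj ↦ ?_⟩
  obtain ⟨C, hC⟩ := hu.isBounded j hj
  obtain ⟨D, hD⟩ := hv.isBounded j hj
  refine ⟨C + D, fun q hq ↦ ?_⟩
  rw [dYk_add j (contDiffAt_sliceY hΩ hu.contDiffOn hq) (contDiffAt_sliceY hΩ hv.contDiffOn hq)]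
  exact (norm_add_le _ _).trans (add_le_add (hC q hq) (hD q hq))

/-- Sums, pointwise form. [folklore] -/
theorem SpatiallyBddUpTo.add' (hΩ : IsOpen Ω) (hu : SpatiallyBddUpTo Ω m u)
    (hv : SpatiallyBddUpTo Ω m v) : SpatiallyBddUpTo Ω m (fun p ↦ u p + v p) :=
  hu.add hΩ hv

/-- Negation. [folklore] -/
theorem SpatiallyBddUpTo.neg (hΩ : IsOpen Ω) (hu : SpatiallyBddUpTo Ω m u) :
    SpatiallyBddUpTo Ω m (fun p ↦ -u p) := by
  have h := hu.clm_comp hΩ (-ContinuousLinearMap.id ℝ W)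
  exact h.congr hΩ fun q _ ↦ by simp

/-- Differences. [folklore] -/
theorem SpatiallyBddUpTo.sub (hΩ : IsOpen Ω) (hu : SpatiallyBddUpTo Ω m u)
    (hv : SpatiallyBddUpTo Ω m v) : SpatiallyBddUpTo Ω m (fun p ↦ u p - v p) := by
  have h := hu.add' hΩ (hv.neg hΩ)
  exact h.congr hΩ fun q _ ↦ by simp [sub_eq_add_neg]

/-- Scalar multiples. [folklore] -/
theorem SpatiallyBddUpTo.const_smul (hΩ : IsOpen Ω) (hu : SpatiallyBddUpTo Ω m u) (c : ℝ) :
    SpatiallyBddUpTo Ω m (fun p ↦ c • u p) :=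
  hu.clm_comp hΩ (c • ContinuousLinearMap.id ℝ W)

/-- Finite sums. [folklore] -/
theorem SpatiallyBddUpTo.sum (hΩ : IsOpen Ω) {κ : Type*} (s : Finset κ) {F : κ → E × ℝ → W}
    (hF : ∀ k ∈ s, SpatiallyBddUpTo Ω m (F k)) :
    SpatiallyBddUpTo Ω m (fun p ↦ ∑ k ∈ s, F k p) := by
  classical
  induction s using Finset.induction_on with
  | empty =>
    simp only [Finset.sum_empty]
    exact SpatiallyBddUpTo.const m 0
  | insert a s ha ih =>
    have h := (hF a (Finset.mem_insert_self a s)).add' hΩ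
      (ih fun k hk ↦ hF k (Finset.mem_insert_of_mem hk))
    refine h.congr hΩ fun q _ ↦ ?_
    simp [Finset.sum_insert ha]

/-- A scalar function times a constant vector. [folklore] -/
theorem SpatiallyBddUpTo.smul_const (hΩ : IsOpen Ω) {f : E × ℝ → ℝ} (hf : SpatiallyBddUpTo Ω m f)
    (w : W) : SpatiallyBddUpTo Ω m (fun p ↦ f p • w) :=
  hf.clm_comp hΩ ((ContinuousLinearMap.id ℝ ℝ).smulRight w)

/-- **Leibniz** (graded): continuous bilinear maps. [folklore] -/
theorem SpatiallyBddUpTo.bilin (hΩ : IsOpen Ω) (B : W₁ →L[ℝ] W₂ →L[ℝ] W₃) {u : E × ℝ → W₁}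
    {v : E × ℝ → W₂} (hu : SpatiallyBddUpTo Ω m u) (hv : SpatiallyBddUpTo Ω m v) :
    SpatiallyBddUpTo Ω m (fun p ↦ B (u p) (v p)) := by
  obtain ⟨Cu, hCu0, hCu⟩ := hu.bound
  obtain ⟨Cv, hCv0, hCv⟩ := hv.bound
  refine ⟨(B.contDiff.comp_contDiffOn hu.contDiffOn).clm_apply hv.contDiffOn, fun j hj ↦ ?_⟩
  refine ⟨‖B‖ * ∑ i ∈ Finset.range (j + 1), (j.choose i : ℝ) * Cu i * Cv (j - i), fun q hq ↦ ?_⟩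
  set S : Set E := {y | (y, q.2) ∈ Ω} with hSdef
  have hS : IsOpen S := isOpen_sliceY hΩ q.2
  have hy : q.1 ∈ S := hq
  have hf := contDiffOn_sliceY hu.contDiffOn q.2
  have hg := contDiffOn_sliceY hv.contDiffOn q.2
  have key := B.norm_iteratedFDerivWithin_le_of_bilinear hf hg hS.uniqueDiffOn hy (n := j)
    (by exact_mod_cast le_top)
  have hL : ‖dYk j (fun p ↦ B (u p) (v p)) q‖ =
      ‖iteratedFDerivWithin ℝ j (fun y ↦ B (u (y, q.2)) (v (y, q.2))) S q.1‖ := by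
    rw [iteratedFDerivWithin_of_isOpen j hS hy]
    rfl
  rw [hL]
  refine key.trans ?_
  refine mul_le_mul_of_nonneg_left (Finset.sum_le_sum fun i hi ↦ ?_) (norm_nonneg B)
  have him : i ≤ j := Nat.lt_succ_iff.1 (Finset.mem_range.1 hi)
  have h1 : ‖iteratedFDerivWithin ℝ i (fun y ↦ u (y, q.2)) S q.1‖ ≤ Cu i := by
    rw [iteratedFDerivWithin_of_isOpen i hS hy]
    exact hCu i (him.trans hj) q hq
  have h2 : ‖iteratedFDerivWithin ℝ (j - i) (fun y ↦ v (y, q.2)) S q.1‖ ≤ Cv (j - i) := by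
    rw [iteratedFDerivWithin_of_isOpen (j - i) hS hy]
    exact hCv (j - i) ((Nat.sub_le j i).trans hj) q hq
  rw [mul_assoc, mul_assoc]
  refine mul_le_mul_of_nonneg_left ?_ (by positivity)
  exact mul_le_mul h1 h2 (norm_nonneg _) (hCu0 i)

/-- Products of real functions (graded Leibniz). [folklore] -/
theorem SpatiallyBddUpTo.mul (hΩ : IsOpen Ω) {f g : E × ℝ → ℝ} (hf : SpatiallyBddUpTo Ω m f)
    (hg : SpatiallyBddUpTo Ω m g) : SpatiallyBddUpTo Ω m (fun p ↦ f p * g p) :=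
  hf.bilin hΩ (ContinuousLinearMap.mul ℝ ℝ) hg

/-- Finite products of real functions. [folklore] -/
theorem SpatiallyBddUpTo.prod (hΩ : IsOpen Ω) {κ : Type*} (s : Finset κ) {F : κ → E × ℝ → ℝ}
    (hF : ∀ k ∈ s, SpatiallyBddUpTo Ω m (F k)) :
    SpatiallyBddUpTo Ω m (fun p ↦ ∏ k ∈ s, F k p) := by
  classical
  induction s using Finset.induction_on with
  | empty =>
    simp only [Finset.prod_empty]
    exact SpatiallyBddUpTo.const m 1
  | insert a s ha ih =>
    have h := (hF a (Finset.mem_insert_self a s)).mul hΩ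
      (ih fun k hk ↦ hF k (Finset.mem_insert_of_mem hk))
    refine h.congr hΩ fun q _ ↦ ?_
    simp [Finset.prod_insert ha]

/-- **Chain rule** (graded): left composition with a map smooth on an open set `U`, when `u`
takes values in a compact subset `K ⊆ U`. [folklore] -/
theorem SpatiallyBddUpTo.comp (hΩ : IsOpen Ω) {U : Set W} (hU : IsOpen U) {K : Set W}
    (hK : IsCompact K) (hKU : K ⊆ U) {R : W → W'} (hR : ContDiffOn ℝ ∞ R U)
    (hu : SpatiallyBddUpTo Ω m u) (hrange : ∀ q ∈ Ω, u q ∈ K) :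
    SpatiallyBddUpTo Ω m (fun p ↦ R (u p)) := by
  have hCR : ∀ i : ℕ, ∃ C, ∀ w ∈ K, ‖iteratedFDerivWithin ℝ i R U w‖ ≤ C := fun i ↦ by
    have hcont : ContinuousOn (iteratedFDerivWithin ℝ i R U) K :=
      (hR.continuousOn_iteratedFDerivWithin (by exact_mod_cast le_top) hU.uniqueDiffOn).mono hKU
    obtain ⟨C, hC⟩ := hK.exists_bound_of_continuousOn hcont
    exact ⟨C, hC⟩
  choose CR hCR using hCR
  obtain ⟨Cu, hCu0, hCu⟩ := hu.bound
  refine ⟨hR.comp hu.contDiffOn fun q hq ↦ hKU (hrange q hq), fun j hj ↦ ?_⟩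
  set C : ℝ := ∑ i ∈ Finset.range (j + 1), |CR i| with hCdef
  set D : ℝ := max 1 (∑ i ∈ Finset.range (j + 1), Cu i) with hDdef
  refine ⟨j.factorial * C * D ^ j, fun q hq ↦ ?_⟩
  set S : Set E := {y | (y, q.2) ∈ Ω} with hSdef
  have hS : IsOpen S := isOpen_sliceY hΩ q.2
  have hy : q.1 ∈ S := hq
  have hf := contDiffOn_sliceY hu.contDiffOn q.2
  have hst : MapsTo (fun y ↦ u (y, q.2)) S U := fun y hy' ↦ hKU (hrange _ hy')
  have hCb : ∀ i, i ≤ j → ‖iteratedFDerivWithin ℝ i R U (u (q.1, q.2))‖ ≤ C := by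
    intro i hi
    refine (hCR i _ (hrange _ hq)).trans ((le_abs_self _).trans ?_)
    rw [hCdef]
    exact Finset.single_le_sum (f := fun k ↦ |CR k|) (fun k _ ↦ abs_nonneg _)
      (Finset.mem_range.2 (Nat.lt_succ_of_le hi))
  have hD1 : 1 ≤ D := le_max_left _ _
  have hDb : ∀ i, 1 ≤ i → i ≤ j → ‖iteratedFDerivWithin ℝ i (fun y ↦ u (y, q.2)) S q.1‖ ≤ D ^ i := by
    intro i hi1 hi
    rw [iteratedFDerivWithin_of_isOpen i hS hy]
    have h1 : ‖iteratedFDeriv ℝ i (fun y ↦ u (y, q.2)) q.1‖ ≤ Cu i := hCu i (hi.trans hj) q hq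
    have h2 : Cu i ≤ ∑ k ∈ Finset.range (j + 1), Cu k :=
      Finset.single_le_sum (f := Cu) (fun k _ ↦ hCu0 k) (Finset.mem_range.2 (Nat.lt_succ_of_le hi))
    have h3 : (∑ k ∈ Finset.range (j + 1), Cu k) ≤ D := le_max_right _ _
    have h4 : D ≤ D ^ i := le_self_pow₀ hD1 (by omega)
    linarith
  have key := norm_iteratedFDerivWithin_comp_le (g := R) (f := fun y ↦ u (y, q.2)) (n := j) (N := ∞)
    hR hf (by exact_mod_cast le_top) hU.uniqueDiffOn hS.uniqueDiffOn hst hy hCb hDb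
  rw [iteratedFDerivWithin_of_isOpen j hS hy] at key
  exact key

/-- **Order shift**: `∂_y u` has one order less. [folklore] -/
theorem SpatiallyBddUpTo.upTo_dY (hΩ : IsOpen Ω) (hu : SpatiallyBddUpTo Ω (m + 1) u) :
    SpatiallyBddUpTo Ω m (dY u) := by
  refine ⟨contDiffOn_dY hΩ hu.contDiffOn, fun j hj ↦ ?_⟩
  obtain ⟨C, hC⟩ := hu.isBounded (j + 1) (Nat.succ_le_succ hj)
  exact ⟨C, fun q hq ↦ by rw [← norm_dYk_succ_eq_norm_dYk_dY]; exact hC q hq⟩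

/-- **Order shift**: order `m + 1` from order `0` and order `m` of `∂_y u`. [folklore] -/
theorem SpatiallyBddUpTo.of_dY (h0 : SpatiallyBddUpTo Ω 0 u) (h1 : SpatiallyBddUpTo Ω m (dY u)) :
    SpatiallyBddUpTo Ω (m + 1) u := by
  refine ⟨h0.contDiffOn, fun j hj ↦ ?_⟩
  cases j with
  | zero => exact h0.isBounded 0 le_rfl
  | succ j =>
    obtain ⟨C, hC⟩ := h1.isBounded j (Nat.le_of_succ_le_succ hj)
    exact ⟨C, fun q hq ↦ by rw [norm_dYk_succ_eq_norm_dYk_dY]; exact hC q hq⟩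

/-- **Order shift** as an equivalence. [folklore] -/
theorem spatiallyBddUpTo_succ_iff_dY (hΩ : IsOpen Ω) :
    SpatiallyBddUpTo Ω (m + 1) u ↔ SpatiallyBddUpTo Ω 0 u ∧ SpatiallyBddUpTo Ω m (dY u) :=
  ⟨fun h ↦ ⟨h.mono (Nat.zero_le _), h.upTo_dY hΩ⟩, fun h ↦ h.1.of_dY h.2⟩

/-- **Reconstruction of `∂_y u` from directional derivatives along a basis**:
`∂_y u = Σᵢ bⁱ ⊗ ∂_{bᵢ} u`, so `∂_y u` is bounded up to order `m` as soon as every `∂_{bᵢ} u` is.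
[folklore] -/
theorem SpatiallyBddUpTo.dY_of_basis [FiniteDimensional ℝ E] (hΩ : IsOpen Ω) {ι : Type*} [Fintype ι]
    (b : Module.Basis ι ℝ E) (h : ∀ i, SpatiallyBddUpTo Ω m (fun p ↦ dY u p (b i))) :
    SpatiallyBddUpTo Ω m (dY u) := by
  -- `A = Σᵢ (bⁱ).smulRight (A bᵢ)` for every `A : E →L W`
  have hrec : ∀ A : E →L[ℝ] W,
      A = ∑ i, ContinuousLinearMap.smulRightL ℝ E W (LinearMap.toContinuousLinearMap (b.coord i))
        (A (b i)) := by
    intro A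
    ext v
    rw [_root_.sum_apply]
    simp only [ContinuousLinearMap.smulRightL_apply_apply, ContinuousLinearMap.smulRight_apply,
      LinearMap.coe_toContinuousLinearMap', Module.Basis.coord_apply]
    conv_lhs => rw [← b.sum_repr v]
    simp only [map_sum, map_smul]
  have hsum := SpatiallyBddUpTo.sum hΩ Finset.univ (F := fun i p ↦
    ContinuousLinearMap.smulRightL ℝ E W (LinearMap.toContinuousLinearMap (b.coord i)) (dY u p (b i)))
    fun i _ ↦ (h i).clm_comp hΩ _
  refine hsum.congr hΩ fun q _ ↦ ?_
  exact (hrec (dY u q)).symm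

/-- Directional spatial derivatives of a `C^∞` function are `C^∞`. [folklore] -/
theorem contDiffOn_dY_apply (hΩ : IsOpen Ω) (hu : ContDiffOn ℝ ∞ u Ω) (v : E) :
    ContDiffOn ℝ ∞ (fun p ↦ dY u p v) Ω :=
  (contDiffOn_dY hΩ hu).clm_apply contDiffOn_const

end UpTo

/-! ### Bounds by integration in time on a cylinder -/

section TimeIntegration

variable {B₀ B : Set E} {t₁ T t₂ : ℝ} {u : E × ℝ → W} {m : ℕ}

/-- **Bounds at one time on a compact set**: for `u` `C^∞` on the open cylinder `B₀ × (t₁, T)`,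
`K ⊆ B₀` compact and `t₂ ∈ (t₁, T)`, every `∂ʲ_y u(·, t₂)` is bounded on `K`. [folklore] -/
theorem exists_forall_norm_dYk_slice_le (hB₀ : IsOpen B₀) {K : Set E} (hK : IsCompact K)
    (hKB₀ : K ⊆ B₀) (ht₂ : t₂ ∈ Ioo t₁ T) (hu : ContDiffOn ℝ ∞ u (B₀ ×ˢ Ioo t₁ T)) (j : ℕ) :
    ∃ C : ℝ, ∀ y ∈ K, ‖dYk j u (y, t₂)‖ ≤ C := by
  have hΩ₀ : IsOpen (B₀ ×ˢ Ioo t₁ T) := hB₀.prod isOpen_Ioo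
  have hcont : ContinuousOn (fun y ↦ dYk j u (y, t₂)) K := by
    have h1 : ContinuousOn (dYk j u) (B₀ ×ˢ Ioo t₁ T) := (contDiffOn_dYk hΩ₀ hu j).continuousOn
    exact h1.comp (continuous_id.prodMk continuous_const).continuousOn fun y hy ↦ ⟨hKB₀ hy, ht₂⟩
  obtain ⟨C, hC⟩ := hK.exists_bound_of_continuousOn hcont
  exact ⟨C, hC⟩

/-- **Bounds by integration in time** (Topping 2006, p. 48: "by integrating with respect to time
we find the same is true also for `l = 0`"): let `u` be `C^∞` on the open cylinder
`B₀ × (t₁, T)`, `B ⊆ B₀`, `t₂ ∈ (t₁, T)`. If the spatial derivatives of order `≤ m` of `∂ₜ u`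
are bounded on `B × (t₁, T)` and those of `u(·, t₂)` are bounded on `B`, then the spatial
derivatives of order `≤ m` of `u` are bounded on `B × (t₁, T)`: `∂ₜ ∂ʲ_y u = ∂ʲ_y ∂ₜ u`
(`dT_dYk`) and the mean value inequality on the time segment between `t₂` and `t`, of length
`≤ T − t₁`. [cite: Topping2006, §5.3, proof of Thm. 5.3.1, p. 48] -/
theorem spatiallyBddUpTo_of_dT (hB₀ : IsOpen B₀) (hBB₀ : B ⊆ B₀) (ht₂ : t₂ ∈ Ioo t₁ T)
    (hu : ContDiffOn ℝ ∞ u (B₀ ×ˢ Ioo t₁ T))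
    (hder : ∀ j ≤ m, ∃ C : ℝ, ∀ q ∈ B ×ˢ Ioo t₁ T, ‖dYk j (dT u) q‖ ≤ C)
    (hinit : ∀ j ≤ m, ∃ C : ℝ, ∀ y ∈ B, ‖dYk j u (y, t₂)‖ ≤ C) :
    SpatiallyBddUpTo (B ×ˢ Ioo t₁ T) m u := by
  have hΩ₀ : IsOpen (B₀ ×ˢ Ioo t₁ T) := hB₀.prod isOpen_Ioo
  refine ⟨hu.mono (prod_mono hBB₀ Subset.rfl), fun j hj ↦ ?_⟩
  obtain ⟨C, hC⟩ := hder j hj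
  obtain ⟨C₀, hC₀⟩ := hinit j hj
  refine ⟨C₀ + |C| * (T - t₁), ?_⟩
  rintro ⟨y, t⟩ ⟨hy, ht⟩
  have hyB₀ : y ∈ B₀ := hBB₀ hy
  -- the path `s ↦ ∂ʲ_y u (y, s)` on `(t₁, T)`
  have hpath : ∀ s ∈ Ioo t₁ T, HasDerivWithinAt (fun s' ↦ dYk j u (y, s')) (dT (dYk j u) (y, s))
      (Ioo t₁ T) s := by
    intro s hs
    have hd : DifferentiableAt ℝ (fun s' ↦ dYk j u (y, s')) s :=
      (contDiffAt_sliceT (q := (y, s)) hΩ₀ (contDiffOn_dYk hΩ₀ hu j) ⟨hyB₀, hs⟩).differentiableAt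
        (by simp)
    exact hd.hasDerivAt.hasDerivWithinAt
  have hbound : ∀ s ∈ Ioo t₁ T, ‖dT (dYk j u) (y, s)‖ ≤ |C| := by
    intro s hs
    rw [dT_dYk (q := (y, s)) hΩ₀ hu j ⟨hyB₀, hs⟩]
    exact (hC (y, s) ⟨hy, hs⟩).trans (le_abs_self C)
  have hmvt := (convex_Ioo t₁ T).norm_image_sub_le_of_norm_hasDerivWithin_le hpath hbound ht₂ ht
  have hlen : ‖t - t₂‖ ≤ T - t₁ := by
    rw [Real.norm_eq_abs, abs_le]
    constructor <;> linarith [ht.1, ht.2, ht₂.1, ht₂.2]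
  have h2 : ‖dYk j u (y, t₂)‖ ≤ C₀ := hC₀ y hy
  change ‖dYk j u (y, t)‖ ≤ C₀ + |C| * (T - t₁)
  calc ‖dYk j u (y, t)‖ ≤ ‖dYk j u (y, t₂)‖ + ‖dYk j u (y, t) - dYk j u (y, t₂)‖ :=
        norm_le_insert' (dYk j u (y, t)) (dYk j u (y, t₂))
    _ ≤ C₀ + |C| * ‖t - t₂‖ := add_le_add h2 hmvt
    _ ≤ C₀ + |C| * (T - t₁) := by gcongr

/-- **Bounds by integration in time, class form**: with `∂ₜ u = v` on `B × (t₁, T)` for some `v`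
bounded up to order `m` there, and `B ⊆ K ⊆ B₀`, `K` compact (so that the bounds at `t₂` are
automatic), `u` is bounded up to order `m` on `B × (t₁, T)`.
[cite: Topping2006, §5.3, proof of Thm. 5.3.1, p. 48] -/
theorem spatiallyBddUpTo_of_dT_eqOn (hB₀ : IsOpen B₀) (hB : IsOpen B) {K : Set E} (hK : IsCompact K)
    (hBK : B ⊆ K) (hKB₀ : K ⊆ B₀) (ht₂ : t₂ ∈ Ioo t₁ T) (hu : ContDiffOn ℝ ∞ u (B₀ ×ˢ Ioo t₁ T))
    {v : E × ℝ → W} (hv : SpatiallyBddUpTo (B ×ˢ Ioo t₁ T) m v)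
    (heq : EqOn (dT u) v (B ×ˢ Ioo t₁ T)) : SpatiallyBddUpTo (B ×ˢ Ioo t₁ T) m u := by
  have hΩ : IsOpen (B ×ˢ Ioo t₁ T) := hB.prod isOpen_Ioo
  refine spatiallyBddUpTo_of_dT hB₀ (hBK.trans hKB₀) ht₂ hu (fun j hj ↦ ?_) fun j _ ↦ ?_
  · obtain ⟨C, hC⟩ := hv.isBounded j hj
    exact ⟨C, fun q hq ↦ by rw [dYk_congr hΩ heq hq j]; exact hC q hq⟩
  · obtain ⟨C, hC⟩ := exists_forall_norm_dYk_slice_le hB₀ hK hKB₀ ht₂ hu j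
    exact ⟨C, fun y hy ↦ hC y (hBK hy)⟩

end TimeIntegration

end Literature.Analysis.Calculus

end
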